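import Summits.CriticalPhenomena.CardyFormulaZ2.Theorems.CardyFlipRussoVoronoiHubFromSmirnovCrossRatioDistortion
import Mathlib

/-!
# Helper `moebius_osculation_circle` — line `moebius-exact-delaunay-dilation-ward`,
# stub S3 `stub_conformalTransport` (crux `VoronoiHubFromSmirnov`, stmt-CriticalPhenomena-6433)

The geometric input of "defects are rare" in the conformal transport of Voronoi percolation
(Benjamini–Schramm 1998, Thm 2.1, via Lemma 4.1 and the planar remark on p. 80: *take the Möbius
transformation which agrees with `f` to second order*): a conformal map sends a small circle of
radius `r` to within `O(r³)` of a true circle, and points at distance `t` outside/inside the circle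
go at least `κ t - O(r³)` outside/inside the image circle.

We prove the quantitative `C¹'¹` form `moebius_osculation_circle`: if on a convex set `B` the map
`h` has complex derivative `h₁`, `h₁` has complex derivative `h₂`, `‖h₁‖ ≥ m > 0`, `‖h₂‖ ≤ L` and
`h₂` is `L`-Lipschitz, then with `κ = m/5`, `r₀ = m/(4(L+1))`, `C = 9L + 3L²/m + 1`, for every
disc `closedBall x (2r) ⊆ B`, `0 < r ≤ r₀`, there are `y` with `dist y (h x) ≤ C r²` and
`0 < ρ' ≤ 2‖h₁ x‖ r` such that `dist (h z) y - ρ' ≥ κ (dist z x - r) - C r³` for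
`r ≤ dist z x ≤ 2r` and `dist (h z) y - ρ' ≤ κ (dist z x - r) + C r³` for `dist z x ≤ r`.

Proof with explicit objects.  Put `a = h₁ x`, `b = h₂ x`, `β = b/(2a)` (`‖β‖ r ≤ 1/8`),
`k = 1/(1 - ‖β‖² r²) ∈ [1, 2]`, and let `M z = h x + a u/(1 - β u)`, `u = z - x`, be the
osculating Möbius map.  **Part A (exact algebra).**  The image of the circle `‖u‖ = r` under `M`
is the circle of centre `y = h x + a c₀`, `c₀ = conj β · r² k`, and radius `ρ' = ‖a‖ r k`:
indeed `u/(1 - βu) - c₀ = k (u - conj β r²)/(1 - βu)` (`mo_moebius_sub_center`) and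
`‖u - conj β r²‖² - r² ‖1 - βu‖² = (1 - ‖β‖² r²)(‖u‖² - r²)` (`mo_norm_identity`), so the signed
distance `D = ‖M z - y‖/‖a‖ - r k` satisfies `D · Q (P + r Q) = ‖u‖² - r²` with
`Q = ‖1 - βu‖ ∈ [3/4, 5/4]`, `P = ‖u - conj β r²‖ ≤ 17r/8`, whence `D ≥ (‖u‖ - r)/5` outside and
`D ≤ (‖u‖ - r)/5` inside (`mo_dilation_real`).  **Part B (Taylor).**  `M` agrees with the Taylor
polynomial `h x + a u + (b/2) u²` up to `a β² u³/(1 - βu)` (`mo_moebius_taylor`), of norm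
`≤ 3 (L²/m) r³`, while `h` agrees with it up to `8 L r³` by two passes of the mean value
inequality (`mo_taylor_remainder`, from `crd_secant_remainder`); so
`|dist (h z) y - dist (M z) y| ≤ C r³` and the inequalities transfer (`mo_local`).  All
[folklore]; context: I. Benjamini, O. Schramm, *Conformal invariance of Voronoi percolation*,
Comm. Math. Phys. 197 (1998) 75–107, Lemma 4.1.
-/

noncomputable section

namespace Summit.CriticalPhenomena.CardyFormulaZ2.Cruxes.VoronoiHubFromSmirnov.MoebiusExactDelaunayDilationWard

open Set Metric
open scoped ComplexConjugate

/-! ### Part A: the osculating Möbius map sends the circle `‖u‖ = r` onto a circle -/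

/-- The norm identity behind the image circle of `u ↦ u / (1 - β u)`: with `s = r²`,
`‖u - conj β · s‖² - s ‖1 - β u‖² = (1 - ‖β‖² s)(‖u‖² - s)`. [folklore] -/
theorem mo_norm_identity (β u : ℂ) (s : ℝ) :
    ‖u - conj β * (s : ℂ)‖ ^ 2 - s * ‖1 - β * u‖ ^ 2 = (1 - ‖β‖ ^ 2 * s) * (‖u‖ ^ 2 - s) := by
  simp only [Complex.sq_norm, Complex.normSq_apply, Complex.sub_re, Complex.sub_im, Complex.mul_re,
    Complex.mul_im, Complex.conj_re, Complex.conj_im, Complex.ofReal_re, Complex.ofReal_im,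
    Complex.one_re, Complex.one_im]
  ring

/-- The Möbius map minus the centre of the image circle: if `k (1 - ‖β‖² s) = 1` then
`u / (1 - β u) - conj β · s k = k (u - conj β · s) / (1 - β u)`. [folklore] -/
theorem mo_moebius_sub_center (β u : ℂ) {s k : ℝ} (hk : k * (1 - ‖β‖ ^ 2 * s) = 1)
    (hv : 1 - β * u ≠ 0) :
    u / (1 - β * u) - conj β * ((s * k : ℝ) : ℂ) =
      (k : ℂ) * (u - conj β * (s : ℂ)) / (1 - β * u) := by
  have hk' : (k : ℂ) * (1 - β * conj β * (s : ℂ)) = 1 := by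
    rw [Complex.mul_conj']
    exact_mod_cast hk
  rw [eq_div_iff hv, sub_mul, div_mul_cancel₀ _ hv]
  push_cast
  linear_combination (-u) * hk'

/-- The Möbius map agrees with its Taylor polynomial of degree two up to `β² u³ / (1 - β u)`.
[folklore] -/
theorem mo_moebius_taylor (β u : ℂ) (hv : 1 - β * u ≠ 0) :
    u / (1 - β * u) - u - β * u ^ 2 = β ^ 2 * u ^ 3 / (1 - β * u) := by
  rw [eq_div_iff hv, sub_mul, sub_mul, div_mul_cancel₀ _ hv]
  ring

/-- Crude two-sided bounds for `‖1 - β u‖` when `‖β u‖ ≤ 1/4`. [folklore] -/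
theorem mo_norm_one_sub_bounds {β u : ℂ} (h : ‖β * u‖ ≤ 1 / 4) :
    3 / 4 ≤ ‖1 - β * u‖ ∧ ‖1 - β * u‖ ≤ 5 / 4 := by
  have h1 := norm_sub_norm_le (1 : ℂ) (β * u)
  have h2 := norm_sub_le (1 : ℂ) (β * u)
  rw [norm_one] at h1 h2
  exact ⟨by linarith, by linarith⟩

/-- **The dilation inequality in real variables.**  With `N = ‖u‖ ≤ 2r`, `P = ‖u - conj β r²‖`,
`Q = ‖1 - β u‖ ∈ [3/4, 5/4]`, `b = ‖β‖`, the identity of `mo_norm_identity` and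
`k (1 - b² r²) = 1`, the signed distance `k P / Q - r k` of the image point to the image circle is
at least `(N - r)/5` outside and at most `(N - r)/5` inside. [folklore] -/
theorem mo_dilation_real {N P Q r b k : ℝ} (hr : 0 < r) (hN0 : 0 ≤ N) (hQ1 : 3 / 4 ≤ Q)
    (hQ2 : Q ≤ 5 / 4) (hP0 : 0 ≤ P) (hP : P ≤ 17 * r / 8)
    (hid : P ^ 2 - r ^ 2 * Q ^ 2 = (1 - b ^ 2 * r ^ 2) * (N ^ 2 - r ^ 2))
    (hk : k * (1 - b ^ 2 * r ^ 2) = 1) :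
    (r ≤ N → 1 / 5 * (N - r) ≤ k * P / Q - r * k) ∧
      (N ≤ r → k * P / Q - r * k ≤ 1 / 5 * (N - r)) := by
  have hQ0 : 0 < Q := by linarith
  have hDQ : (k * P / Q - r * k) * Q = k * (P - r * Q) := by
    field_simp
  have hDT : (k * P / Q - r * k) * (Q * (P + r * Q)) = (N - r) * (N + r) := by
    calc (k * P / Q - r * k) * (Q * (P + r * Q)) = (k * P / Q - r * k) * Q * (P + r * Q) := by ring
      _ = k * (P ^ 2 - r ^ 2 * Q ^ 2) := by rw [hDQ]; ring
      _ = (N - r) * (N + r) := by rw [hid]; linear_combination (N ^ 2 - r ^ 2) * hk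
  have hT0 : 0 < Q * (P + r * Q) := by positivity
  have hT : Q * (P + r * Q) ≤ 5 * r := by
    calc Q * (P + r * Q) ≤ 5 / 4 * (17 * r / 8 + r * (5 / 4)) :=
          mul_le_mul hQ2 (add_le_add hP (mul_le_mul_of_nonneg_left hQ2 hr.le)) (by positivity)
            (by norm_num)
      _ ≤ 5 * r := by linarith
  constructor
  · intro hrN
    have hE0 : 0 ≤ (N - r) * (N + r) := mul_nonneg (by linarith) (by linarith)
    have hD0 : 0 ≤ k * P / Q - r * k := nonneg_of_mul_nonneg_left (hDT ▸ hE0) hT0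
    have h1 : (N - r) * (2 * r) ≤ (k * P / Q - r * k) * (5 * r) :=
      calc (N - r) * (2 * r) ≤ (N - r) * (N + r) :=
            mul_le_mul_of_nonneg_left (by linarith) (by linarith)
        _ = (k * P / Q - r * k) * (Q * (P + r * Q)) := hDT.symm
        _ ≤ (k * P / Q - r * k) * (5 * r) := mul_le_mul_of_nonneg_left hT hD0
    have h2 : (2 * (N - r)) * r ≤ (5 * (k * P / Q - r * k)) * r := by linarith
    have h3 := le_of_mul_le_mul_right h2 hr
    linarith
  · intro hNr
    have hE0 : 0 ≤ (r - N) * (N + r) := mul_nonneg (by linarith) (by linarith)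
    have hDT' : -(k * P / Q - r * k) * (Q * (P + r * Q)) = (r - N) * (N + r) := by
      rw [neg_mul, hDT]; ring
    have hD0 : 0 ≤ -(k * P / Q - r * k) := nonneg_of_mul_nonneg_left (hDT' ▸ hE0) hT0
    have h1 : (r - N) * r ≤ -(k * P / Q - r * k) * (5 * r) :=
      calc (r - N) * r ≤ (r - N) * (N + r) := mul_le_mul_of_nonneg_left (by linarith) (by linarith)
        _ = -(k * P / Q - r * k) * (Q * (P + r * Q)) := hDT'.symm
        _ ≤ -(k * P / Q - r * k) * (5 * r) := mul_le_mul_of_nonneg_left hT hD0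
    have h2 : (r - N) * r ≤ (5 * -(k * P / Q - r * k)) * r := by linarith
    have h3 := le_of_mul_le_mul_right h2 hr
    linarith

/-! ### Part B: third-order Taylor control of `h` and the local statement -/

/-- Third-order Taylor remainder from the secant estimate `crd_secant_remainder`: on a convex
`S ∋ c` inside the ball of radius `r` about `c`,
`‖h z - h c - h₁ c (z - c) - (h₂ c / 2)(z - c)²‖ ≤ L r² ‖z - c‖` for `z ∈ S`. [folklore] -/
theorem mo_taylor_remainder {h h₁ h₂ : ℂ → ℂ} {S : Set ℂ} {c : ℂ} {L r : ℝ} (hS : Convex ℝ S)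
    (hd1 : ∀ w ∈ S, HasDerivWithinAt h (h₁ w) S w)
    (hd2 : ∀ w ∈ S, HasDerivWithinAt h₁ (h₂ w) S w) (hc : c ∈ S)
    (hball : ∀ w ∈ S, ‖w - c‖ ≤ r) (hLip : ∀ w ∈ S, ‖h₂ w - h₂ c‖ ≤ L * r) (hr : 0 ≤ r)
    (hL : 0 ≤ L) {z : ℂ} (hz : z ∈ S) :
    ‖h z - h c - h₁ c * (z - c) - h₂ c / 2 * (z - c) ^ 2‖ ≤ L * r ^ 2 * ‖z - c‖ := by
  by_cases hzc : z = c
  · subst hzc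
    simp
  have key := crd_secant_remainder hS hd1 hd2 hc hball hLip hr hL hz hc hzc
  have hzc' : z - c ≠ 0 := sub_ne_zero.2 hzc
  have e : h z - h c - h₁ c * (z - c) - h₂ c / 2 * (z - c) ^ 2 =
      ((h z - h c) / (z - c) - h₁ c - h₂ c * ((z + c) / 2 - c)) * (z - c) := by
    field_simp
    ring
  rw [e, norm_mul]
  exact mul_le_mul_of_nonneg_right key (norm_nonneg _)

/-- **The local statement.**  For a disc `closedBall x (2r) ⊆ B` with `0 < r ≤ m / (4 (L + 1))`:
the centre `y = h x + h₁ x · c₀` and radius `ρ' = ‖h₁ x‖ r k` of the image of the circle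
`‖z - x‖ = r` under the osculating Möbius map `z ↦ h x + h₁ x (z - x)/(1 - β (z - x))`,
`β = h₂ x / (2 h₁ x)`, `k = 1/(1 - ‖β‖² r²)`, `c₀ = conj β · r² k`, satisfy the two dilation
inequalities with `κ = m / 5` and `C = 9 L + 3 L² / m + 1`. [folklore] -/
theorem mo_local {h h₁ h₂ : ℂ → ℂ} {B : Set ℂ} {L m : ℝ} (hm : 0 < m) (hL : 0 ≤ L)
    (hd1 : ∀ z ∈ B, HasDerivAt h (h₁ z) z) (hd2 : ∀ z ∈ B, HasDerivAt h₁ (h₂ z) z)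
    (hm1 : ∀ z ∈ B, m ≤ ‖h₁ z‖) (hL2 : ∀ z ∈ B, ‖h₂ z‖ ≤ L)
    (hLip : ∀ z ∈ B, ∀ w ∈ B, ‖h₂ z - h₂ w‖ ≤ L * ‖z - w‖) {x : ℂ} {r : ℝ} (hr : 0 < r)
    (hrm : r ≤ m / (4 * (L + 1))) (hsub : closedBall x (2 * r) ⊆ B) :
    ∃ (y : ℂ) (ρ' : ℝ), 0 < ρ' ∧ ρ' ≤ 2 * ‖h₁ x‖ * r ∧
      dist y (h x) ≤ (9 * L + 3 * (L ^ 2 / m) + 1) * r ^ 2 ∧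
      ∀ z ∈ closedBall x (2 * r),
        (r ≤ dist z x →
          m / 5 * (dist z x - r) - (9 * L + 3 * (L ^ 2 / m) + 1) * r ^ 3 ≤ dist (h z) y - ρ') ∧
        (dist z x ≤ r →
          dist (h z) y - ρ' ≤ m / 5 * (dist z x - r) + (9 * L + 3 * (L ^ 2 / m) + 1) * r ^ 3) := by
  -- data at the centre: `a = h₁ x`, `b = h₂ x`, `β = b / (2a)`
  have hx : x ∈ B := hsub (mem_closedBall_self (by positivity))
  obtain ⟨a, ha⟩ : ∃ a, h₁ x = a := ⟨_, rfl⟩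
  obtain ⟨b, hb⟩ : ∃ b, h₂ x = b := ⟨_, rfl⟩
  have ham : m ≤ ‖a‖ := ha ▸ hm1 x hx
  have ha0 : 0 < ‖a‖ := hm.trans_le ham
  have ha0' : a ≠ 0 := norm_pos_iff.1 ha0
  have hbL : ‖b‖ ≤ L := hb ▸ hL2 x hx
  obtain ⟨β, hβ_def⟩ : ∃ β : ℂ, β = b / (2 * a) := ⟨_, rfl⟩
  have haβ : a * β = b / 2 := by
    rw [hβ_def]
    field_simp
  have hβn : ‖β‖ = ‖b‖ / (2 * ‖a‖) := by
    rw [hβ_def, norm_div, norm_mul, RCLike.norm_ofNat]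
  have haβn : ‖a‖ * ‖β‖ = ‖b‖ / 2 := by
    rw [hβn]
    field_simp
  have hβL : ‖β‖ ≤ L / (2 * m) := by
    rw [hβn]
    exact div_le_div₀ hL hbL (by positivity) (by linarith)
  have hβr : ‖β‖ * r ≤ 1 / 8 := by
    have h4 : r * (4 * (L + 1)) ≤ m := (le_div_iff₀ (by positivity)).1 hrm
    calc ‖β‖ * r ≤ L / (2 * m) * r := mul_le_mul_of_nonneg_right hβL hr.le
      _ = L * r / (2 * m) := by ring
      _ ≤ 1 / 8 := by rw [div_le_iff₀ (by positivity)]; nlinarith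
  -- the conformal factor `k` of the image circle
  have h0 : 0 ≤ ‖β‖ * r := by positivity
  have ht : ‖β‖ ^ 2 * r ^ 2 ≤ 1 / 64 := by nlinarith
  have ht0 : 0 ≤ ‖β‖ ^ 2 * r ^ 2 := by positivity
  have hpos : 0 < 1 - ‖β‖ ^ 2 * r ^ 2 := by linarith
  obtain ⟨k, hk_def⟩ : ∃ k : ℝ, k = 1 / (1 - ‖β‖ ^ 2 * r ^ 2) := ⟨_, rfl⟩
  have hk : k * (1 - ‖β‖ ^ 2 * r ^ 2) = 1 := by rw [hk_def]; exact div_mul_cancel₀ _ hpos.ne'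
  have hk1 : 1 ≤ k := by rw [hk_def, one_le_div hpos]; linarith
  have hk2 : k ≤ 2 := by rw [hk_def, div_le_iff₀ hpos]; linarith
  have hk0 : 0 ≤ k := by linarith
  -- centre `y = h x + a c₀`, `c₀ = conj β r² k`, and radius `ρ' = ‖a‖ r k`
  refine ⟨h x + a * (conj β * ((r ^ 2 * k : ℝ) : ℂ)), ‖a‖ * (r * k),
    mul_pos ha0 (mul_pos hr (by linarith)), ?_, ?_, ?_⟩
  · rw [ha]
    calc ‖a‖ * (r * k) ≤ ‖a‖ * (r * 2) :=
          mul_le_mul_of_nonneg_left (mul_le_mul_of_nonneg_left hk2 hr.le) (norm_nonneg a)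
      _ = 2 * ‖a‖ * r := by ring
  · rw [dist_eq_norm, add_sub_cancel_left, norm_mul, norm_mul, Complex.norm_conj,
      Complex.norm_of_nonneg (by positivity), ← mul_assoc, haβn]
    have h1 : ‖b‖ / 2 * (r ^ 2 * k) ≤ L / 2 * (r ^ 2 * 2) :=
      mul_le_mul (by linarith) (mul_le_mul_of_nonneg_left hk2 (sq_nonneg r)) (by positivity)
        (by positivity)
    have h2 : L * r ^ 2 ≤ (9 * L + 3 * (L ^ 2 / m) + 1) * r ^ 2 :=
      mul_le_mul_of_nonneg_right (by linarith [div_nonneg (sq_nonneg L) hm.le]) (sq_nonneg r)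
    linarith
  -- the dilation inequalities at `z = x + u`
  intro z hz
  obtain ⟨u, hu⟩ : ∃ u, z - x = u := ⟨_, rfl⟩
  have hN : ‖u‖ ≤ 2 * r := by rw [← hu]; exact mem_closedBall_iff_norm.1 hz
  have hdist : dist z x = ‖u‖ := by rw [dist_eq_norm, hu]
  have hβu : ‖β * u‖ ≤ 1 / 4 := by
    rw [norm_mul]
    calc ‖β‖ * ‖u‖ ≤ ‖β‖ * (2 * r) := mul_le_mul_of_nonneg_left hN (norm_nonneg _)
      _ = ‖β‖ * r * 2 := by ring
      _ ≤ 1 / 4 := by linarith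
  obtain ⟨hQ1, hQ2⟩ := mo_norm_one_sub_bounds hβu
  have hv : 1 - β * u ≠ 0 := norm_pos_iff.1 (by linarith)
  have hP : ‖u - conj β * ((r ^ 2 : ℝ) : ℂ)‖ ≤ 17 * r / 8 := by
    refine (norm_sub_le _ _).trans ?_
    rw [norm_mul, Complex.norm_conj, Complex.norm_of_nonneg (sq_nonneg r)]
    nlinarith [mul_le_mul_of_nonneg_right hβr hr.le]
  -- Part A: signed distance of the Möbius image to the image circle
  have hdil := mo_dilation_real hr (norm_nonneg u) hQ1 hQ2 (norm_nonneg _) hP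
    (mo_norm_identity β u (r ^ 2)) hk
  have hG : ‖a * ((k : ℂ) * (u - conj β * ((r ^ 2 : ℝ) : ℂ)) / (1 - β * u))‖ =
      ‖a‖ * (k * ‖u - conj β * ((r ^ 2 : ℝ) : ℂ)‖ / ‖1 - β * u‖) := by
    rw [norm_mul, norm_div, norm_mul, Complex.norm_of_nonneg hk0]
  -- Part B: `h z - y - (M z - y) = (Taylor remainder of h) - a β² u³ / (1 - β u)`
  have hsplit : h z - (h x + a * (conj β * ((r ^ 2 * k : ℝ) : ℂ))) -
      a * ((k : ℂ) * (u - conj β * ((r ^ 2 : ℝ) : ℂ)) / (1 - β * u)) =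
      (h z - h x - a * u - b / 2 * u ^ 2) - a * (β ^ 2 * u ^ 3 / (1 - β * u)) := by
    rw [← mo_moebius_sub_center β u hk hv, ← mo_moebius_taylor β u hv]
    linear_combination (-(u ^ 2)) * haβ
  have hS : Convex ℝ (closedBall x (2 * r)) := convex_closedBall x (2 * r)
  have hxS : x ∈ closedBall x (2 * r) := mem_closedBall_self (by positivity)
  have hR₃ : ‖h z - h x - a * u - b / 2 * u ^ 2‖ ≤ 8 * L * r ^ 3 := by
    have key := mo_taylor_remainder (r := 2 * r) hS
      (fun w hw => (hd1 w (hsub hw)).hasDerivWithinAt)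
      (fun w hw => (hd2 w (hsub hw)).hasDerivWithinAt) hxS
      (fun w hw => mem_closedBall_iff_norm.1 hw)
      (fun w hw => (hLip w (hsub hw) x hx).trans
        (mul_le_mul_of_nonneg_left (mem_closedBall_iff_norm.1 hw) hL)) (by positivity) hL hz
    rw [ha, hb, hu] at key
    calc _ ≤ L * (2 * r) ^ 2 * ‖u‖ := key
      _ ≤ L * (2 * r) ^ 2 * (2 * r) := mul_le_mul_of_nonneg_left hN (by positivity)
      _ = 8 * L * r ^ 3 := by ring
  have hMo : ‖a * (β ^ 2 * u ^ 3 / (1 - β * u))‖ ≤ 3 * (L ^ 2 / m) * r ^ 3 := by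
    rw [norm_mul, norm_div, norm_mul, norm_pow, norm_pow]
    have h1 : ‖a‖ * ‖β‖ ^ 2 ≤ L ^ 2 / (4 * m) := by
      calc ‖a‖ * ‖β‖ ^ 2 = ‖b‖ / 2 * ‖β‖ := by rw [← haβn]; ring
        _ ≤ L / 2 * (L / (2 * m)) := mul_le_mul (by linarith) hβL (norm_nonneg _) (by positivity)
        _ = L ^ 2 / (4 * m) := by ring
    have h2 : ‖u‖ ^ 3 / ‖1 - β * u‖ ≤ (2 * r) ^ 3 / (3 / 4) :=
      div_le_div₀ (by positivity) (pow_le_pow_left₀ (norm_nonneg _) hN 3) (by norm_num) hQ1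
    calc ‖a‖ * (‖β‖ ^ 2 * ‖u‖ ^ 3 / ‖1 - β * u‖)
        = (‖a‖ * ‖β‖ ^ 2) * (‖u‖ ^ 3 / ‖1 - β * u‖) := by ring
      _ ≤ L ^ 2 / (4 * m) * ((2 * r) ^ 3 / (3 / 4)) :=
          mul_le_mul h1 h2 (by positivity) (by positivity)
      _ = 8 / 3 * (L ^ 2 / m * r ^ 3) := by ring
      _ ≤ 3 * (L ^ 2 / m) * r ^ 3 := by
          nlinarith [mul_nonneg (div_nonneg (sq_nonneg L) hm.le) (pow_nonneg hr.le 3)]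
  have hE : ‖h z - (h x + a * (conj β * ((r ^ 2 * k : ℝ) : ℂ))) -
      a * ((k : ℂ) * (u - conj β * ((r ^ 2 : ℝ) : ℂ)) / (1 - β * u))‖ ≤
      (9 * L + 3 * (L ^ 2 / m) + 1) * r ^ 3 := by
    rw [hsplit]
    refine (norm_sub_le _ _).trans ?_
    have : 0 ≤ (L + 1) * r ^ 3 := by positivity
    nlinarith [hR₃, hMo]
  have habs := abs_norm_sub_norm_le (h z - (h x + a * (conj β * ((r ^ 2 * k : ℝ) : ℂ))))
    (a * ((k : ℂ) * (u - conj β * ((r ^ 2 : ℝ) : ℂ)) / (1 - β * u)))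
  rw [hG] at habs
  have hle := abs_le.1 (habs.trans hE)
  rw [hdist, dist_eq_norm]
  constructor
  · intro hrN
    have h1 := hdil.1 hrN
    have h2 : m * (1 / 5 * (‖u‖ - r)) ≤
        ‖a‖ * (k * ‖u - conj β * ((r ^ 2 : ℝ) : ℂ)‖ / ‖1 - β * u‖ - r * k) :=
      (mul_le_mul_of_nonneg_right ham (by linarith)).trans
        (mul_le_mul_of_nonneg_left h1 (norm_nonneg a))
    linarith [hle.1]
  · intro hNr
    have h1 := hdil.2 hNr
    have h2 : ‖a‖ * (k * ‖u - conj β * ((r ^ 2 : ℝ) : ℂ)‖ / ‖1 - β * u‖ - r * k) ≤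
        ‖a‖ * (1 / 5 * (‖u‖ - r)) := mul_le_mul_of_nonneg_left h1 (norm_nonneg a)
    have h3 : ‖a‖ * (1 / 5 * (‖u‖ - r)) ≤ m * (1 / 5 * (‖u‖ - r)) :=
      mul_le_mul_of_nonpos_right ham (by linarith)
    linarith [hle.2]

/-! ### The stub -/

/-- **BS98 Lemma 4.1 (planar, metric form): a conformal map sends small circles to within `O(r³)`
of true circles, with definite dilation across the circle.**  If on a convex set `B` the map `h`
has complex derivative `h₁`, `h₁` has complex derivative `h₂`, `‖h₁‖ ≥ m > 0`, `‖h₂‖ ≤ L` and `h₂`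
is `L`-Lipschitz, then there are `C`, `κ > 0`, `r₀ > 0` such that for every disc
`closedBall x (2r) ⊆ B` with `0 < r ≤ r₀` there are a centre `y` with `dist y (h x) ≤ C r²` and a
radius `0 < ρ' ≤ 2 ‖h₁ x‖ r` such that on `closedBall x (2r)` the signed distance
`dist (h z) y - ρ'` is at least `κ (dist z x - r) - C r³` outside the circle `dist z x = r` and at
most `κ (dist z x - r) + C r³` inside it.  (Explicitly `κ = m/5`, `r₀ = m / (4 (L + 1))`,
`C = 9 L + 3 L²/m + 1`; the comparison circle is the image of `dist z x = r` under the osculating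
Möbius map, Benjamini–Schramm 1998, proof of Lemma 4.1.) -/
theorem moebius_osculation_circle : ∀ (h h₁ h₂ : ℂ → ℂ) (B : Set ℂ) (L m : ℝ), Convex ℝ B → 0 < m → (∀ z ∈ B, HasDerivAt h (h₁ z) z) → (∀ z ∈ B, HasDerivAt h₁ (h₂ z) z) → (∀ z ∈ B, m ≤ ‖h₁ z‖) → (∀ z ∈ B, ‖h₂ z‖ ≤ L) → (∀ z ∈ B, ∀ w ∈ B, ‖h₂ z - h₂ w‖ ≤ L * ‖z - w‖) → ∃ C κ r₀ : ℝ, 0 < κ ∧ 0 < r₀ ∧ ∀ (x : ℂ) (r : ℝ), 0 < r → r ≤ r₀ → Metric.closedBall x (2 * r) ⊆ B → ∃ (y : ℂ) (ρ' : ℝ), 0 < ρ' ∧ ρ' ≤ 2 * ‖h₁ x‖ * r ∧ dist y (h x) ≤ C * r ^ 2 ∧ ∀ z ∈ Metric.closedBall x (2 * r), (r ≤ dist z x → κ * (dist z x - r) - C * r ^ 3 ≤ dist (h z) y - ρ') ∧ (dist z x ≤ r → dist (h z) y - ρ' ≤ κ * (dist z x - r) + C * r ^ 3) := by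
  intro h h₁ h₂ B L m _ hm hd1 hd2 hm1 hL2 hLip
  by_cases hL : 0 ≤ L
  swap
  · refine ⟨0, 1, 1, one_pos, one_pos, fun x r hr _ hsub => ?_⟩
    have hx : x ∈ B := hsub (mem_closedBall_self (by positivity))
    exact absurd ((norm_nonneg _).trans (hL2 x hx)) hL
  exact ⟨9 * L + 3 * (L ^ 2 / m) + 1, m / 5, m / (4 * (L + 1)), by positivity, by positivity,
    fun x r hr hrm hsub => mo_local hm hL hd1 hd2 hm1 hL2 hLip hr hrm hsub⟩

end Summit.CriticalPhenomena.CardyFormulaZ2.Cruxes.VoronoiHubFromSmirnov.MoebiusExactDelaunayDilationWard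

end
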